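import Summits.MatrixMultiplication.MatrixMultiplication.Theorems.SaturationLadderTowerChain
import HarnessLib

/-!
# Route `SaturationLadder` on Strassen's spectrum, XVII: THE GENERIC THREE-FAMILY SQUARING TOWER — every stage an exact roof `B·θ₁ ≤ A·ε₀ + C·ε₂`

decomp-mm lens 1 «grading / quantitative ladder», gen 50, kernel K50-W (part 1 of 3; part 2 = `SaturationLadderTowerCeiling`,
part 3 = `SaturationLadderTowerSchoenhage`).  Def-free, sorry-free support module beneath the deciding crux `SubexpSaturation`
(stmt-MatrixMultiplication-25909) of `route-MatrixMultiplication-SaturationLadder`; cut of record UNCHANGED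
(`closes (h₁ : SubexpSaturation) (h₂ : SubexpToPoly) (h₃ : PolyToFinite) (h₄ : TailDescentTwo) (h₅ : SquareFromTwo)`).
`θ = specMMPoint K φ`, `εᵢ = 1 − θᵢ`.

THE GENERALISATION (critic ask g50 FIRST, memo NODE-SaturationLadder-g50 §2).  Kernel XV (`thinTowerChain`) read the isolated
squaring tower of a SYMMETRIC anchored family `⟨1,Q,1⟩ ⊕ ⊕ᵢ⟨aᵢ,bᵢ,aᵢ⟩`.  Here the family is an ARBITRARY anchored three-legged
direct sum `⊕ᵢ⟨kᵢ,mᵢ,nᵢ⟩` with an anchor index `i₀`, `k_{i₀} = n_{i₀} = 1`, `m_{i₀} = Q`, all formats `≥ 1`, realised by an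
isolated-anchor approximate algorithm of length `r = Q + X + Y` (`∑kᵢmᵢ = Q + X`, `∑mᵢnᵢ = Q + Y`: the two leg sums) that is
OUTPUT-PERFECT (`∑kᵢnᵢ = r`).  Route `FarEdgeDescent`'s stage map (XXXII-B `isolated_stage`: square, keep the `p² − 1` pairs
other than (anchor, anchor), re-anchor) preserves every one of these properties with the recursion
`X' = (Q+X)² − Q²`, `Y' = (Q+Y)² − Q²`, `r' = r²`, `Q' = r² − X' − Y' (= Q² + 2XY)`, and the three SHAPE SUMS
`A = ∑kn log k`, `B = ∑kn log m`, `C = ∑kn log n` obey `A' = 2rA`, `C' = 2rC`, `B' = 2rB − 2log Q + log Q'` (polarised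
drop-anchor identity `sum_pairDrop_polar`).  By K48-P (`weightedRoof_of_perfectReadout`, Coppersmith's type selection in
spectral form) EVERY stage is an exact roof over every field: `B_j·θ₁ ≤ A_j·ε₀ + C_j·ε₂` — i.e. (part 2) the thin point
`(t_j, ρ) = (B_j/A_j, C_j/A_j)` satisfies `ω_K(1, t_j, ρ) = 1 + ρ` with `ρ = C₀/A₀` CONSTANT along the tower.  Only the seven
number sequences are exported.  Symmetric families (`k = n`, `X = Y`, `A = C`) recover XV.
* §1 the four-factor log-shape identity and the thin three-family recursion (`thinChain₃_exists`, primitive recursion);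
* §2 bookkeeping of the kept pairs of an anchored family (`pairSum_mul_eq`, `consPair_sum_mul`, `consPair_sum_log`);
* §3 one stage (`stage₃`) and the tower `thinTowerChain₃`.
Tags: `SubexpSaturation` (h₁) NEC-side ladder · WEAKER · ATTACKED.  No defs.
[cite: Schonhage1981, §5] [cite: Pan1984, Props. 16.2–16.5] [cite: Coppersmith1982, Theorem (BCS 1997 Thm. (15.51))]
[cite: Stothers2010, §1, Thm. 8] [cite: Strassen1988, Thm. 3.8] [cite: KnuthTAOCP2, §4.6.4, Ex. 67(g),(h)]
-/

set_option linter.dupNamespace false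

noncomputable section

open scoped BigOperators Polynomial
open Polynomial

namespace Summit.MatrixMultiplication.MatrixMultiplication.Theorems.SaturationLadderTowerThree

open Literature.Computability.AlgebraicComplexity
open Summit.MatrixMultiplication.MatrixMultiplication.Theorems.FarEdgeDescentIsolatedStep
open Summit.MatrixMultiplication.MatrixMultiplication.Theorems.FarEdgeDescentIsolatedSquare
open Summit.MatrixMultiplication.MatrixMultiplication.Theorems.FarEdgeDescentIsolatedChain
open Summit.MatrixMultiplication.MatrixMultiplication.Theorems.FarEdgeDescentTowerChain
open Summit.MatrixMultiplication.MatrixMultiplication.Theorems.SaturationLadderPerfectPacking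
open Summit.MatrixMultiplication.MatrixMultiplication.Theorems.SaturationLadderTowerChain

/-! ## §1 The four-factor log-shape identity and the thin three-family recursion -/

/-- **Log-shape of a product block, three families**: `(xx')(yy') log(zz') = (xy log z)·(x'y') + (xy)·(x'y' log z')`
(casts from `ℕ`). [folklore] -/
theorem cast_mul₄_log_mul {x x' y y' z z' : ℕ} (hz : 1 ≤ z) (hz' : 1 ≤ z') :
    (((x * x' : ℕ) : ℕ) : ℝ) * ((y * y' : ℕ) : ℝ) * Real.log ((z * z' : ℕ) : ℝ) =
      ((x : ℝ) * y * Real.log z) * ((x' : ℝ) * y') + ((x : ℝ) * y) * ((x' : ℝ) * y' * Real.log z') := by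
  have h1 : ((z : ℕ) : ℝ) ≠ 0 := by exact_mod_cast (show z ≠ 0 by omega)
  have h2 : ((z' : ℕ) : ℝ) ≠ 0 := by exact_mod_cast (show z' ≠ 0 by omega)
  push_cast
  rw [Real.log_mul h1 h2]
  ring

/-- **The thin three-family recursion exists** (primitive recursion on a septuple):
`X' = (Q+X)² − Q²`, `Y' = (Q+Y)² − Q²`, `r' = r²`, `Q' = r² − X' − Y'`, `A' = 2rA`, `B' = 2rB − 2 log Q + log Q'`, `C' = 2rC`.
[folklore] -/
theorem thinChain₃_exists (r₀ Q₀ X₀ Y₀ : ℕ) (A₀ B₀ C₀ : ℝ) :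
    ∃ (r Q X Y : ℕ → ℕ) (A B C : ℕ → ℝ),
      r 0 = r₀ ∧ Q 0 = Q₀ ∧ X 0 = X₀ ∧ Y 0 = Y₀ ∧ A 0 = A₀ ∧ B 0 = B₀ ∧ C 0 = C₀ ∧
      (∀ j, X (j + 1) = (Q j + X j) ^ 2 - Q j ^ 2) ∧
      (∀ j, Y (j + 1) = (Q j + Y j) ^ 2 - Q j ^ 2) ∧
      (∀ j, r (j + 1) = r j ^ 2) ∧
      (∀ j, Q (j + 1) = r j ^ 2 - ((Q j + X j) ^ 2 - Q j ^ 2) - ((Q j + Y j) ^ 2 - Q j ^ 2)) ∧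
      (∀ j, A (j + 1) = 2 * (r j : ℝ) * A j) ∧
      (∀ j, B (j + 1) = 2 * (r j : ℝ) * B j - 2 * Real.log (Q j) + Real.log (Q (j + 1))) ∧
      (∀ j, C (j + 1) = 2 * (r j : ℝ) * C j) := by
  let step : (ℕ × ℕ × ℕ × ℕ) × (ℝ × ℝ × ℝ) → (ℕ × ℕ × ℕ × ℕ) × (ℝ × ℝ × ℝ) := fun x =>
    ((x.1.1 ^ 2,
      x.1.1 ^ 2 - ((x.1.2.1 + x.1.2.2.1) ^ 2 - x.1.2.1 ^ 2) - ((x.1.2.1 + x.1.2.2.2) ^ 2 - x.1.2.1 ^ 2),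
      (x.1.2.1 + x.1.2.2.1) ^ 2 - x.1.2.1 ^ 2,
      (x.1.2.1 + x.1.2.2.2) ^ 2 - x.1.2.1 ^ 2),
      (2 * (x.1.1 : ℝ) * x.2.1,
        2 * (x.1.1 : ℝ) * x.2.2.1 - 2 * Real.log (x.1.2.1 : ℝ) +
          Real.log ((x.1.1 ^ 2 - ((x.1.2.1 + x.1.2.2.1) ^ 2 - x.1.2.1 ^ 2) -
            ((x.1.2.1 + x.1.2.2.2) ^ 2 - x.1.2.1 ^ 2) : ℕ) : ℝ),
        2 * (x.1.1 : ℝ) * x.2.2.2))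
  let U : ℕ → (ℕ × ℕ × ℕ × ℕ) × (ℝ × ℝ × ℝ) := fun j =>
    Nat.rec (motive := fun _ => (ℕ × ℕ × ℕ × ℕ) × (ℝ × ℝ × ℝ)) ((r₀, Q₀, X₀, Y₀), (A₀, B₀, C₀))
      (fun _ x => step x) j
  have hU : ∀ j, U (j + 1) = step (U j) := fun j => rfl
  refine ⟨fun j => (U j).1.1, fun j => (U j).1.2.1, fun j => (U j).1.2.2.1, fun j => (U j).1.2.2.2,
    fun j => (U j).2.1, fun j => (U j).2.2.1, fun j => (U j).2.2.2, rfl, rfl, rfl, rfl, rfl, rfl, rfl,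
    fun j => ?_, fun j => ?_, fun j => ?_, fun j => ?_, fun j => ?_, fun j => ?_, fun j => ?_⟩ <;>
  simp only [hU, step]

/-! ## §2 Bookkeeping of the kept pairs of an anchored family

An anchored family over `Fin P` with anchor `i₀` is squared and re-anchored along route `FarEdgeDescent`'s drop-anchor
enumeration `φ` of the `P² − 1` pairs other than `(i₀,i₀)`; the new family over `Fin (M+1)` (`P² = M + 1`) is
`Fin.cons x₀' (w ↦ x(φw)₁·x(φw)₂)` with the new anchor at `0`. -/

/-- **Sums over a squared anchored family**: `∑ (new x)(new y) = x₀'y₀' + ∑_{kept pairs}(xx')(yy')`. [folklore] -/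
theorem consPair_sum_mul {P M : ℕ} (φ : Fin M → Fin P × Fin P) (x y : Fin P → ℕ) (x₀ y₀ : ℕ) :
    (∑ i, (Fin.cons x₀ (fun w => x (φ w).1 * x (φ w).2) : Fin (M + 1) → ℕ) i *
        (Fin.cons y₀ (fun w => y (φ w).1 * y (φ w).2) : Fin (M + 1) → ℕ) i) =
      x₀ * y₀ + ∑ w, (x (φ w).1 * x (φ w).2) * (y (φ w).1 * y (φ w).2) := by
  rw [Fin.sum_univ_succ]
  simp only [Fin.cons_zero, Fin.cons_succ]

section Anchored

variable {P : ℕ} (i₀ : Fin P) {M : ℕ} (hM : P * P = M + 1) (φ : Fin M → Fin P × Fin P)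
  (hφ : φ = fun w => finProdFinEquiv.symm (Fin.cast hM.symm
    ((Fin.cast hM (finProdFinEquiv (i₀, i₀))).succAbove w)))

include hφ

/-- Kernel XXXII-B's counting identity for products of two formats: `(x₀y₀)² + ∑_{kept}(xx')(yy') = (∑xy)²`. [folklore] -/
theorem pairSum_mul_eq (x y : Fin P → ℕ) :
    x i₀ * y i₀ * (x i₀ * y i₀) + ∑ w, (x (φ w).1 * x (φ w).2) * (y (φ w).1 * y (φ w).2) =
      (∑ i, x i * y i) ^ 2 := by
  rw [← sum_pairDrop_add' (fun i => x i * y i) hM i₀ φ hφ]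
  congr 1
  exact Finset.sum_congr rfl fun w _ => by ring

/-- **Log-shapes of a squared anchored family**: with `k_{i₀} = n_{i₀} = 1`,
`∑ (kk')(nn') log(new x) = log x₀' + 2·(∑kn)·(∑kn log x) − 2 log x_{i₀}` — one identity for all three legs
(`x = k`: `A' = 2WA`; `x = n`: `C' = 2WC`; `x = m`, `x_{i₀} = Q`, `x₀' = Q'`: `B' = log Q' + 2WB − 2 log Q`). [folklore] -/
theorem consPair_sum_log (k n x : Fin P → ℕ) (hk₀ : k i₀ = 1) (hn₀ : n i₀ = 1) (hx : ∀ i, 1 ≤ x i) (x₀' : ℕ) :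
    (∑ i, (((Fin.cons 1 (fun w => k (φ w).1 * k (φ w).2) : Fin (M + 1) → ℕ) i : ℕ) : ℝ) *
        (Fin.cons 1 (fun w => n (φ w).1 * n (φ w).2) : Fin (M + 1) → ℕ) i *
        Real.log ((Fin.cons x₀' (fun w => x (φ w).1 * x (φ w).2) : Fin (M + 1) → ℕ) i)) =
      Real.log x₀' + 2 * (∑ i, (k i : ℝ) * n i) * (∑ i, (k i : ℝ) * n i * Real.log (x i)) -
        2 * Real.log (x i₀) := by
  have hterm : ∀ w, (((k (φ w).1 * k (φ w).2 : ℕ) : ℕ) : ℝ) * ((n (φ w).1 * n (φ w).2 : ℕ) : ℝ) *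
      Real.log ((x (φ w).1 * x (φ w).2 : ℕ) : ℝ) =
      ((k (φ w).1 : ℝ) * n (φ w).1 * Real.log (x (φ w).1)) * ((k (φ w).2 : ℝ) * n (φ w).2) +
      ((k (φ w).1 : ℝ) * n (φ w).1) * ((k (φ w).2 : ℝ) * n (φ w).2 * Real.log (x (φ w).2)) :=
    fun w => cast_mul₄_log_mul (hx _) (hx _)
  have hpol := sum_pairDrop_polar (fun i => (k i : ℝ) * n i * Real.log (x i)) (fun i => (k i : ℝ) * n i)
    hM i₀ φ hφ
  simp only [hk₀, hn₀, Nat.cast_one, one_mul, mul_one] at hpol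
  rw [Fin.sum_univ_succ]
  simp only [Fin.cons_zero, Fin.cons_succ, Nat.cast_one, one_mul]
  rw [Finset.sum_congr rfl fun w _ => hterm w, hpol]
  ring

end Anchored

/-! ## §3 One stage, and the generic three-family thin tower -/

variable (K : Type) [Field K]

/-- **ONE STAGE OF THE GENERIC TOWER** (XXXII-B `isolated_stage` + the bookkeeping of §2): an output-perfect isolated-anchor
realization of an anchored family `⊕ᵢ⟨kᵢ,mᵢ,nᵢ⟩` (`k_{i₀} = n_{i₀} = 1`, `m_{i₀} = q`, leg sums `q + X`, `q + Y`, length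
`ϱ = q + X + Y = ∑kn`) yields one of the squared-and-re-anchored family, of length `ϱ²`, with anchor middle `q² + 2XY`, leg sums
`(q² + 2XY) + (2qX + X²)`, `(q² + 2XY) + (2qY + Y²)`, output count `ϱ²` (PERFECT AGAIN) and shape sums `2ϱA`,
`2ϱB − 2 log q + log(q² + 2XY)`, `2ϱC`. [cite: Pan1984, Prop. 16.5] [cite: Stothers2010, §1, Thm. 8] -/
theorem stage₃ {P : ℕ} {k m n : Fin P → ℕ} {i₀ : Fin P} {q X Y ϱ h : ℕ} (hk₀ : k i₀ = 1) (hn₀ : n i₀ = 1)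
    (hm₀ : m i₀ = q) (hk : ∀ i, 1 ≤ k i) (hm : ∀ i, 1 ≤ m i) (hn : ∀ i, 1 ≤ n i)
    (hSX : ∑ i, k i * m i = q + X) (hSY : ∑ i, m i * n i = q + Y) (hsum : q + X + Y = ϱ)
    (hW : ∑ i, k i * n i = ϱ)
    (hinv : ∃ (u : Fin ϱ → _ → K[X]) (v : Fin ϱ → _ → K[X]) (w : Fin ϱ → _ → K[X]) (d : Fin ϱ → K[X]),
      IsApproxDecomposition h (matMulDirectSum K k m n) u v w ∧ (∀ s, d s ≠ 0) ∧
        ∀ b c, ¬ (b.1 = i₀ ∧ c.1 = i₀) → ∑ s, d s * v s b * w s c = 0) :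
    ∃ (P' : ℕ) (k' m' n' : Fin P' → ℕ) (i₀' : Fin P'),
      k' i₀' = 1 ∧ n' i₀' = 1 ∧ m' i₀' = q ^ 2 + 2 * X * Y ∧ (∀ i, 1 ≤ k' i) ∧ (∀ i, 1 ≤ m' i) ∧
      (∀ i, 1 ≤ n' i) ∧
      (∑ i, k' i * m' i) = (q ^ 2 + 2 * X * Y) + (2 * q * X + X ^ 2) ∧
      (∑ i, m' i * n' i) = (q ^ 2 + 2 * X * Y) + (2 * q * Y + Y ^ 2) ∧
      (q ^ 2 + 2 * X * Y) + (2 * q * X + X ^ 2) + (2 * q * Y + Y ^ 2) = ϱ * ϱ ∧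
      (∑ i, k' i * n' i) = ϱ * ϱ ∧
      (∑ i, (k' i : ℝ) * n' i * Real.log (k' i)) = 2 * (ϱ : ℝ) * ∑ i, (k i : ℝ) * n i * Real.log (k i) ∧
      (∑ i, (k' i : ℝ) * n' i * Real.log (m' i)) =
        2 * (ϱ : ℝ) * (∑ i, (k i : ℝ) * n i * Real.log (m i)) - 2 * Real.log q +
          Real.log ((q ^ 2 + 2 * X * Y : ℕ) : ℝ) ∧
      (∑ i, (k' i : ℝ) * n' i * Real.log (n' i)) = 2 * (ϱ : ℝ) * ∑ i, (k i : ℝ) * n i * Real.log (n i) ∧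
      ∃ (h' : ℕ) (u : Fin (ϱ * ϱ) → _ → K[X]) (v : Fin (ϱ * ϱ) → _ → K[X]) (w : Fin (ϱ * ϱ) → _ → K[X])
        (d : Fin (ϱ * ϱ) → K[X]),
        IsApproxDecomposition h' (matMulDirectSum K k' m' n') u v w ∧ (∀ s, d s ≠ 0) ∧
          ∀ b c, ¬ (b.1 = i₀' ∧ c.1 = i₀') → ∑ s, d s * v s b * w s c = 0 := by
  classical
  have hP : 0 < P := Fin.pos i₀
  obtain ⟨M, hM⟩ : ∃ M, P * P = M + 1 :=
    ⟨P * P - 1, (Nat.succ_pred_eq_of_pos (Nat.mul_pos hP hP)).symm⟩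
  obtain ⟨φ, hφ⟩ : ∃ φ : Fin M → Fin P × Fin P, φ = fun w => finProdFinEquiv.symm
      (Fin.cast hM.symm ((Fin.cast hM (finProdFinEquiv (i₀, i₀))).succAbove w)) := ⟨_, rfl⟩
  have hφinj : Function.Injective φ := by subst hφ; exact pairDrop_injective hM _
  have hφ₀ : ∀ w, φ w ≠ (i₀, i₀) := by subst hφ; exact pairDrop_ne hM i₀
  -- the three pair sums over the kept pairs
  have ha := pairSum_mul_eq i₀ hM φ hφ k m
  have hb := pairSum_mul_eq i₀ hM φ hφ m n
  have hc := pairSum_mul_eq i₀ hM φ hφ k n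
  rw [hk₀, hm₀, hSX] at ha
  rw [hm₀, hn₀, hSY] at hb
  rw [hk₀, hn₀, hW] at hc
  simp only [one_mul, mul_one] at ha hb hc
  have hSXw : (∑ w, (k (φ w).1 * k (φ w).2) * (m (φ w).1 * m (φ w).2)) = 2 * q * X + X ^ 2 :=
    Nat.add_left_cancel (ha.trans (by ring))
  have hSYw : (∑ w, (m (φ w).1 * m (φ w).2) * (n (φ w).1 * n (φ w).2)) = 2 * q * Y + Y ^ 2 :=
    Nat.add_left_cancel (hb.trans (by ring))
  have hSWw : 1 + (∑ w, (k (φ w).1 * k (φ w).2) * (n (φ w).1 * n (φ w).2)) = ϱ * ϱ := hc.trans (sq ϱ)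
  have hϱsq : ϱ * ϱ = (q ^ 2 + 2 * X * Y) + (2 * q * X + X ^ 2) + (2 * q * Y + Y ^ 2) := by
    rw [← hsum]
    ring
  have hq : 1 ≤ q := hm₀ ▸ hm i₀
  have hq' : 1 ≤ q ^ 2 + 2 * X * Y := (Nat.one_le_pow 2 q hq).trans (Nat.le_add_right _ _)
  have st := isolated_stage K k m n hinv φ hφinj hφ₀ (q := q ^ 2 + 2 * X * Y)
    (le_of_eq (by rw [hSXw, hSYw, hϱsq]))
  have hWr : (∑ i, (k i : ℝ) * n i) = ϱ := by exact_mod_cast hW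
  refine ⟨M + 1, _, _, _, 0, by simp, by simp, by simp,
    cons_mid_one_le _ 1 (fun w => one_le_mul_of_one_le k hk (φ w)) le_rfl,
    cons_mid_one_le _ _ (fun w => one_le_mul_of_one_le m hm (φ w)) hq',
    cons_mid_one_le _ 1 (fun w => one_le_mul_of_one_le n hn (φ w)) le_rfl, ?_, ?_, hϱsq.symm, ?_, ?_, ?_,
    ?_, st⟩
  · -- `∑ k'm' = Q' + X'`
    rw [consPair_sum_mul, one_mul, hSXw]
  · -- `∑ m'n' = Q' + Y'`
    rw [consPair_sum_mul, mul_one, hSYw]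
  · -- output-perfectness squares: `W' = W² = ϱ²`
    rw [consPair_sum_mul, one_mul, hSWw]
  · -- `A' = 2ϱA`
    rw [consPair_sum_log i₀ hM φ hφ k n k hk₀ hn₀ hk 1, hWr, hk₀]
    simp
  · -- `B' = log Q' + 2ϱB − 2 log q`
    rw [consPair_sum_log i₀ hM φ hφ k n m hk₀ hn₀ hm (q ^ 2 + 2 * X * Y), hWr, hm₀]
    ring
  · -- `C' = 2ϱC`
    rw [consPair_sum_log i₀ hM φ hφ k n n hk₀ hn₀ hn 1, hWr, hn₀]
    simp

/-- **THE THIN READING OF THE GENERIC ISOLATED SQUARING TOWER.**  From an isolated-anchor approximate realization of the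
anchored family `⊕ᵢ⟨kᵢ,mᵢ,nᵢ⟩` (anchor `i₀`: `k_{i₀} = n_{i₀} = 1`, `m_{i₀} = Q₀ ≥ 1`; all formats `≥ 1`) of length
`r₀ = Q₀ + X₀ + Y₀` (`∑kᵢmᵢ = Q₀ + X₀`, `∑mᵢnᵢ = Q₀ + Y₀`) that is OUTPUT-PERFECT (`∑kᵢnᵢ = r₀`): sequences `r, Q, X, Y`
(`Q + X + Y = r`, `X' = (Q+X)² − Q²`, `Y' = (Q+Y)² − Q²`, `r' = r²`, `Q' = Q² + 2XY`, `Q ≥ 1`) and the SHAPE SUMS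
`A₀ = ∑kn log k`, `B₀ = ∑kn log m`, `C₀ = ∑kn log n`, `A' = 2rA`, `B' = 2rB − 2log Q + log Q'`, `C' = 2rC`, `B ≥ 0`,
such that EVERY stage is an exact thin roof over `K`: `B_j·θ₁ ≤ A_j·ε₀ + C_j·ε₂` for every universal spectral point — each
stage is an actual isolated-anchor algorithm (`stage₃`) whose length EQUALS its number of output entries, and K48-P
`weightedRoof_of_perfectReadout` reads the roof off it.  XV `thinTowerChain` is the case `k = n`.
[cite: Pan1984, Props. 16.2–16.5] [cite: Schonhage1981, §5] [cite: Coppersmith1982, Theorem (BCS 1997 Thm. (15.51))]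
[cite: Stothers2010, §1, Thm. 8] [cite: Strassen1988, Thm. 3.8] -/
theorem thinTowerChain₃ {P : ℕ} (k m n : Fin P → ℕ) (i₀ : Fin P) (hk₀ : k i₀ = 1) (hn₀ : n i₀ = 1)
    (hk : ∀ i, 1 ≤ k i) (hm : ∀ i, 1 ≤ m i) (hn : ∀ i, 1 ≤ n i) {X₀ Y₀ r₀ h₀ : ℕ}
    (hX₀ : ∑ i, k i * m i = m i₀ + X₀) (hY₀ : ∑ i, m i * n i = m i₀ + Y₀)
    (hsum₀ : m i₀ + X₀ + Y₀ = r₀) (hW₀ : ∑ i, k i * n i = r₀)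
    (hinv₀ : ∃ (u : Fin r₀ → _ → K[X]) (v : Fin r₀ → _ → K[X]) (w : Fin r₀ → _ → K[X])
      (d : Fin r₀ → K[X]),
      IsApproxDecomposition h₀ (matMulDirectSum K k m n) u v w ∧ (∀ s, d s ≠ 0) ∧
        ∀ b c, ¬ (b.1 = i₀ ∧ c.1 = i₀) → ∑ s, d s * v s b * w s c = 0) :
    ∃ (r Q X Y : ℕ → ℕ) (A B C : ℕ → ℝ),
      r 0 = r₀ ∧ Q 0 = m i₀ ∧ X 0 = X₀ ∧ Y 0 = Y₀ ∧
      A 0 = ∑ i, (k i : ℝ) * n i * Real.log (k i) ∧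
      B 0 = ∑ i, (k i : ℝ) * n i * Real.log (m i) ∧
      C 0 = ∑ i, (k i : ℝ) * n i * Real.log (n i) ∧
      (∀ j, Q j + X j + Y j = r j) ∧ (∀ j, 1 ≤ Q j) ∧
      (∀ j, X (j + 1) = (Q j + X j) ^ 2 - Q j ^ 2) ∧
      (∀ j, Y (j + 1) = (Q j + Y j) ^ 2 - Q j ^ 2) ∧
      (∀ j, r (j + 1) = r j ^ 2) ∧
      (∀ j, Q (j + 1) = Q j ^ 2 + 2 * X j * Y j) ∧
      (∀ j, A (j + 1) = 2 * (r j : ℝ) * A j) ∧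
      (∀ j, B (j + 1) = 2 * (r j : ℝ) * B j - 2 * Real.log (Q j) + Real.log (Q (j + 1))) ∧
      (∀ j, C (j + 1) = 2 * (r j : ℝ) * C j) ∧
      (∀ j, 0 ≤ B j) ∧
      (∀ j (F : SpectralMap K), IsUniversalSpectralPoint K F →
        B j * specMMPoint K F 1 ≤ A j * (1 - specMMPoint K F 0) + C j * (1 - specMMPoint K F 2)) := by
  classical
  obtain ⟨r, Q, X, Y, A, B, C, h0r, h0Q, h0X, h0Y, h0A, h0B, h0C, hX, hY, hr, hQ, hA, hB, hC⟩ :=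
    thinChain₃_exists r₀ (m i₀) X₀ Y₀ (∑ i, (k i : ℝ) * n i * Real.log (k i))
      (∑ i, (k i : ℝ) * n i * Real.log (m i)) (∑ i, (k i : ℝ) * n i * Real.log (n i))
  have eX : ∀ j, X (j + 1) = 2 * Q j * X j + X j ^ 2 := fun j => by
    rw [hX]
    exact Nat.sub_eq_of_eq_add (by ring)
  have eY : ∀ j, Y (j + 1) = 2 * Q j * Y j + Y j ^ 2 := fun j => by
    rw [hY]
    exact Nat.sub_eq_of_eq_add (by ring)
  -- `Q' = Q² + 2XY` as soon as stage `j` is tight (`Q + X + Y = r`)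
  have hQ1 : ∀ j, Q j + X j + Y j = r j → Q (j + 1) = Q j ^ 2 + 2 * X j * Y j := fun j hsum => by
    have hϱsq : r j ^ 2 = X (j + 1) + (Y (j + 1) + (Q j ^ 2 + 2 * X j * Y j)) := by
      rw [eX, eY, ← hsum]
      ring
    rw [hQ, ← hX, ← hY, hϱsq, Nat.add_sub_cancel_left, Nat.add_sub_cancel_left]
  -- the invariant: stage `j` is an OUTPUT-PERFECT isolated-anchor algorithm on an anchored family with the recorded numbers
  have key : ∀ j, ∃ (P' : ℕ) (k' m' n' : Fin P' → ℕ) (i₀' : Fin P') (ϱ : ℕ),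
      k' i₀' = 1 ∧ n' i₀' = 1 ∧ m' i₀' = Q j ∧ ϱ = r j ∧ (∀ i, 1 ≤ k' i) ∧ (∀ i, 1 ≤ m' i) ∧
      (∀ i, 1 ≤ n' i) ∧ (∑ i, k' i * m' i) = Q j + X j ∧ (∑ i, m' i * n' i) = Q j + Y j ∧
      Q j + X j + Y j = ϱ ∧ (∑ i, k' i * n' i) = ϱ ∧
      (∑ i, (k' i : ℝ) * n' i * Real.log (k' i)) = A j ∧
      (∑ i, (k' i : ℝ) * n' i * Real.log (m' i)) = B j ∧
      (∑ i, (k' i : ℝ) * n' i * Real.log (n' i)) = C j ∧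
      ∃ (h : ℕ) (u : Fin ϱ → _ → K[X]) (v : Fin ϱ → _ → K[X]) (w : Fin ϱ → _ → K[X])
        (d : Fin ϱ → K[X]),
        IsApproxDecomposition h (matMulDirectSum K k' m' n') u v w ∧ (∀ s, d s ≠ 0) ∧
          ∀ b c, ¬ (b.1 = i₀' ∧ c.1 = i₀') → ∑ s, d s * v s b * w s c = 0 := by
    intro j
    induction j with
    | zero =>
      refine ⟨P, k, m, n, i₀, r₀, hk₀, hn₀, h0Q.symm, h0r.symm, hk, hm, hn, ?_, ?_, ?_, hW₀,
        h0A.symm, h0B.symm, h0C.symm, h₀, hinv₀⟩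
      · rw [h0Q, h0X, hX₀]
      · rw [h0Q, h0Y, hY₀]
      · rw [h0Q, h0X, h0Y, hsum₀]
    | succ j ih =>
      obtain ⟨P', k', m', n', i₀', ϱ, hk₀', hn₀', hm₀', hϱ, hk', hm', hn', hSX, hSY, hsum, hW, hAj, hBj,
        hCj, h, hinv⟩ := ih
      obtain ⟨P'', k'', m'', n'', i₀'', gk₀, gn₀, gm₀, gk, gm, gn, gSX, gSY, gsum, gW, gA, gB, gC, ginv⟩ :=
        stage₃ K hk₀' hn₀' hm₀' hk' hm' hn' hSX hSY hsum hW hinv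
      have hQ' := hQ1 j (hsum.trans hϱ)
      have hr' : r (j + 1) = ϱ * ϱ := by rw [hr, ← hϱ, sq ϱ]
      refine ⟨P'', k'', m'', n'', i₀'', ϱ * ϱ, gk₀, gn₀, ?_, hr'.symm, gk, gm, gn, ?_, ?_, ?_, gW, ?_, ?_,
        ?_, ginv⟩
      · rw [hQ', gm₀]
      · rw [hQ', eX, gSX]
      · rw [hQ', eY, gSY]
      · rw [hQ', eX, eY, gsum]
      · rw [gA, hAj, hA, hϱ]
      · rw [gB, hBj, hB, hϱ, hQ']
      · rw [gC, hCj, hC, hϱ]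
  refine ⟨r, Q, X, Y, A, B, C, h0r, h0Q, h0X, h0Y, h0A, h0B, h0C, fun j => ?_, fun j => ?_, hX, hY, hr,
    fun j => ?_, hA, hB, hC, fun j => ?_, fun j F hF => ?_⟩
  · obtain ⟨P', k', m', n', i₀', ϱ, -, -, -, hϱ, -, -, -, -, -, hsum, -⟩ := key j
    rw [← hϱ, hsum]
  · obtain ⟨P', k', m', n', i₀', ϱ, -, -, hm₀', -, -, hm', -⟩ := key j
    rw [← hm₀']
    exact hm' i₀'
  · obtain ⟨P', k', m', n', i₀', ϱ, -, -, -, hϱ, -, -, -, -, -, hsum, -⟩ := key j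
    exact hQ1 j (hsum.trans hϱ)
  · obtain ⟨P', k', m', n', i₀', ϱ, -, -, -, -, -, hm', -, -, -, -, -, -, hBj, -⟩ := key j
    rw [← hBj]
    exact shapeSum_nonneg m' hm'
  · obtain ⟨P', k', m', n', i₀', ϱ, -, -, -, -, hk', hm', hn', -, -, -, hW, hAj, hBj, hCj, h, hinv⟩ :=
      key j
    have hbr := algBorderRank_le_of_isolated K hinv
    have hpos : ∀ i, 1 ≤ k' i ∧ 1 ≤ m' i ∧ 1 ≤ n' i := fun i => ⟨hk' i, hm' i, hn' i⟩
    have hWr : (∑ i, (k' i : ℝ) * n' i) = ϱ := by exact_mod_cast hW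
    have hread : ∀ G : SpectralMap K, IsUniversalSpectralPoint K G →
        ∑ i, G (matMulTensor K (k' i) (m' i) (n' i)) ≤ ∑ i, (k' i : ℝ) * n' i := by
      intro G hG
      rw [hWr]
      exact sum_map_le_of_algBorderRank_le hG _ _ _ hbr
    have hroof := weightedRoof_of_perfectReadout hpos (Fin.pos i₀') hread hF
    rw [hAj, hBj, hCj] at hroof
    exact hroof

end Summit.MatrixMultiplication.MatrixMultiplication.Theorems.SaturationLadderTowerThree

end
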